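import Summits.CriticalPhenomena.PercolationContinuityZ3.Theorems.PercNearOneGluingNoHeavyLowerTailTerminalEdgeStepXiHqtLeFive

/-!
# `NoHeavyLowerTail` (crux stmt-CriticalPhenomena-4575, closed): the AG⁺ terminal-edge Bernstein pieces `xiB₁, xiB₂` are FIRST-ORDER nonnegative at
# the cut-vertex stratum `CUT:b:ay|c` along every elementary attachment direction — by two Harris covariances of the hidden attachment vertex
# (support file, prover seat `prim-l12-p2` gen 3; `--supports stmt-CriticalPhenomena-4575`; pure algebra, `ring`/`positivity`)

Companion of `…TerminalEdgeStepCutVertexFirstOrder` (the `H_{q+t}` pieces): same setting, same variables, same directions, same certificate shape —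
see that file's module docstring for the derivation and the meaning of `α, η, γ, A, N, M, e₁, e₂, e₃, f₁`, of the attachment direction `F_A`, the merge
direction `ℬ¹`, the Harris covariances `C₁ = (1−α)A − αN − αM` (in `G₁`) and `C₂` (in `G₁/{a=y}`), and of `ρ', κ₁, κ₂` (the `(b,w′,c)` law of `G₂`).
AG⁺ itself is a theorem (prim-ineq-prove-3, four-copy switching certificate, 2026-08-20); its apex-edge step (BΞ1),(BΞ2) is census-clean but, like the
`H_{q+t}` step, has no law-level certificate at `V3` (exact pseudo-laws, prim-facecert 2026-08-19 / prim-l12-p2 g3 memo FINDING-g3-HQT-STEP-HIDDEN-VERTEX.md);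
this file shows the step is nevertheless first-order valid there for the structural reason named in the title.  Nothing is claimed beyond first order.
-/

namespace Summit.CriticalPhenomena.PercolationContinuityZ3.Theorems.TerminalEdgeStep.CutVertexFirstOrderXi

open Summit.CriticalPhenomena.PercolationContinuityZ3.Theorems.TerminalEdgeStep

section Algebra

variable {R : Type*} [CommRing R]

/-- First-order coefficient `Λ_A` of the AG⁺ first piece `xiB₁` at `V3 = CUT:b:ay|c` along the attachment direction `F_A` (attach `c` to the side-1 vertex `w`) (explicit cubic; variables as in the module docstring). [this work] -/
def xiB₁_lamA (α η γ A N M e₁ e₂ e₃ f₁ : R) : R :=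
  2 * α * η * γ ^ 3 * M + α ^ 2 * γ ^ 3 * e₂ - α ^ 2 * γ ^ 3 * e₁ + 3 * α ^ 2 * γ ^ 3 * M - η * γ ^ 3 * M - α * γ ^ 3 * e₂ + α * γ ^ 3 * e₁ - 3 * α * γ ^ 3 * M - 4 * α * η * γ ^ 2 * M - 2 * α ^ 2 * γ ^ 2 * e₂ + 2 * α ^ 2 * γ ^ 2 * e₁ - 6 * α ^ 2 * γ ^ 2 * M + η * γ ^ 2 * M + α * γ ^ 2 * e₂ - α * γ ^ 2 * e₁ + 3 * α * γ ^ 2 * M + 2 * α * η * γ * M + α ^ 2 * γ * e₂ - α ^ 2 * γ * e₁ + 3 * α ^ 2 * γ * M + η * γ * M + η * γ * N + η * γ * A + α * γ * e₃ + α * γ * e₂ + 3 * α * γ * M + 3 * α * γ * N + 3 * α * γ * A - γ * f₁ - γ * e₃ - γ * e₁ - 3 * γ * A - η * M - η * N - η * A - α * e₃ - α * e₂ - 3 * α * M - 3 * α * N - 3 * α * A + f₁ + e₃ + e₁ + 3 * A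

/-- Second-order coefficient of the same expansion (bookkeeping only). [this work] -/
def xiB₁_attachR₂ (α η γ A N M e₁ e₂ e₃ f₁ : R) : R :=
  η * γ ^ 3 * M ^ 2 + η * γ ^ 3 * N * M - η * γ ^ 3 * A * M - 2 * α * γ ^ 3 * M * f₁ - α * γ ^ 3 * M * e₃ + 2 * α * γ ^ 3 * M * e₂ - 3 * α * γ ^ 3 * M * e₁ + 3 * α * γ ^ 3 * M ^ 2 + α * γ ^ 3 * N * e₂ - α * γ ^ 3 * N * e₁ + 3 * α * γ ^ 3 * N * M - α * γ ^ 3 * A * e₂ + α * γ ^ 3 * A * e₁ - 3 * α * γ ^ 3 * A * M + γ ^ 3 * M * f₁ + γ ^ 3 * M * e₃ + γ ^ 3 * M * e₁ + γ ^ 3 * A * e₂ - γ ^ 3 * A * e₁ + 3 * γ ^ 3 * A * M - 2 * η * γ ^ 2 * M ^ 2 - 3 * η * γ ^ 2 * N * M + 2 * η * γ ^ 2 * A * M + 5 * α * γ ^ 2 * M * f₁ + 2 * α * γ ^ 2 * M * e₃ - 4 * α * γ ^ 2 * M * e₂ + 6 * α * γ ^ 2 * M * e₁ - 6 * α * γ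 ^ 2 * M ^ 2 - 3 * α * γ ^ 2 * N * e₂ + 3 * α * γ ^ 2 * N * e₁ - 9 * α * γ ^ 2 * N * M + 2 * α * γ ^ 2 * A * e₂ - 2 * α * γ ^ 2 * A * e₁ + 6 * α * γ ^ 2 * A * M - γ ^ 2 * M * f₁ - γ ^ 2 * M * e₃ - γ ^ 2 * M * e₁ - γ ^ 2 * A * e₂ + γ ^ 2 * A * e₁ - 3 * γ ^ 2 * A * M + η * γ * M ^ 2 + 3 * η * γ * N * M - η * γ * A * M - 4 * α * γ * M * f₁ - α * γ * M * e₃ + 2 * α * γ * M * e₂ - 3 * α * γ * M * e₁ + 3 * α * γ * M ^ 2 + 3 * α * γ * N * e₂ - 3 * α * γ * N * e₁ + 9 * α * γ * N * M - α * γ * A * e₂ + α * γ * A * e₁ - 3 * α * γ * A * M - γ * M * f₁ + γ * N * e₂ - γ * N * e₁ + 3 * γ * N * M - η * N * M + α * M * f₁ - α * N * e₂ + α * N * e₁ - 3 * α * N * M + M * f₁ - N * e₂ + N * e₁ - 3 * N * M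

/-- Third-order coefficient of the same expansion (bookkeeping only). [this work] -/
def xiB₁_attachR₃ (_α _η γ A N M e₁ e₂ e₃ f₁ : R) : R :=
  -γ ^ 3 * M ^ 2 * f₁ - γ ^ 3 * M ^ 2 * e₃ - γ ^ 3 * M ^ 2 * e₁ - γ ^ 3 * N * M * f₁ - γ ^ 3 * N * M * e₃ - γ ^ 3 * N * M * e₁ + γ ^ 3 * A * M * f₁ - 2 * γ ^ 3 * A * M * e₂ + 2 * γ ^ 3 * A * M * e₁ - 3 * γ ^ 3 * A * M ^ 2 - γ ^ 3 * A * N * e₂ + γ ^ 3 * A * N * e₁ - 3 * γ ^ 3 * A * N * M + 2 * γ ^ 2 * M ^ 2 * f₁ + 2 * γ ^ 2 * M ^ 2 * e₃ + 2 * γ ^ 2 * M ^ 2 * e₁ + 3 * γ ^ 2 * N * M * f₁ + 3 * γ ^ 2 * N * M * e₃ + 3 * γ ^ 2 * N * M * e₁ - 3 * γ ^ 2 * A * M * f₁ + 4 * γ ^ 2 * A * M * e₂ - 4 * γ ^ 2 * A * M * e₁ + 6 * γ ^ 2 * A * M ^ 2 + 3 * γ ^ 2 * A * N * e₂ - 3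 * γ ^ 2 * A * N * e₁ + 9 * γ ^ 2 * A * N * M - γ * M ^ 2 * f₁ - γ * M ^ 2 * e₃ - γ * M ^ 2 * e₁ - 3 * γ * N * M * f₁ - 3 * γ * N * M * e₃ - 3 * γ * N * M * e₁ + 3 * γ * A * M * f₁ - 2 * γ * A * M * e₂ + 2 * γ * A * M * e₁ - 3 * γ * A * M ^ 2 - 3 * γ * A * N * e₂ + 3 * γ * A * N * e₁ - 9 * γ * A * N * M + N * M * f₁ + N * M * e₃ + N * M * e₁ - A * M * f₁ + A * N * e₂ - A * N * e₁ + 3 * A * N * M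

/-- **Expansion of `xiB₁` at the cut-vertex stratum `V3` along the attachment direction `F_A` (attach `c` to the side-1 vertex `w`)**: the value at `ε = 0` is `0` and the `ε`-coefficient is `xiB₁_lamA`. [this work] -/
theorem xiB₁_attach_expansion (α η γ A N M e₁ e₂ e₃ f₁ : R) (ε : R) :
    xiB₁ (α * γ - γ - α + 1 + ε * (γ * M + γ * N - M - N)) (-α * γ + α + ε * (γ * A - A)) (ε * (-γ * M + M)) (-α * γ + γ + ε * (-γ * M - γ * N + N)) (α * γ + ε * (γ * M - γ * A + A)) (-η * γ + η + ε * (γ * f₁ + γ * e₁ - f₁ - e₁)) (ε * (-γ * e₂ + e₂)) (ε * (-γ * e₃ + e₃)) (ε * (-γ * e₁ + e₁)) (η * γ + ε * (-γ * f₁ + γ * e₂ - γ * e₁ + f₁)) =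
      ε * xiB₁_lamA α η γ A N M e₁ e₂ e₃ f₁ + ε ^ 2 * xiB₁_attachR₂ α η γ A N M e₁ e₂ e₃ f₁ + ε ^ 3 * xiB₁_attachR₃ α η γ A N M e₁ e₂ e₃ f₁ := by
  simp only [xiB₁, xiB₁_lamA, xiB₁_attachR₂, xiB₁_attachR₃]
  ring

/-- Certificate form of `xiB₁_lamA`: a nonnegative integer combination of the two Harris covariances `C₁, C₂` and the atoms (`ρ = 1−α−η`, `γ' = 1−γ`, `u = N−f₁`, `v = M−e₁`). [this work] -/
def xiB₁_certA (α η ρ γ γ' _A _u _f₁ v e₁ e₂ e₃ C₁ C₂ : R) : R :=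
  C₂ * ρ * γ' ^ 3 + 2 * C₂ * ρ * γ * γ' ^ 2 + C₂ * ρ * γ ^ 2 * γ' + e₃ * η * ρ * γ' ^ 3 + e₂ * η * ρ * γ' ^ 3 + e₂ * α * η * γ' ^ 3 + 2 * e₃ * η * ρ * γ * γ' ^ 2 + 2 * e₂ * η * ρ * γ * γ' ^ 2 + 2 * v * α * η * γ * γ' ^ 2 + e₃ * η * ρ * γ ^ 2 * γ' + e₂ * η * ρ * γ ^ 2 * γ' + e₁ * η * ρ * γ ^ 2 * γ' + v * η * ρ * γ ^ 2 * γ' + C₂ * η * γ ^ 2 * γ' + e₃ * η ^ 2 * γ' ^ 3 + e₂ * η ^ 2 * γ' ^ 3 + 2 * C₁ * η * γ' ^ 3 + 2 * e₃ * η ^ 2 * γ * γ' ^ 2 + 2 * e₂ * η ^ 2 * γ * γ' ^ 2 + 2 * e₁ * α * η * γ * γ' ^ 2 + e₃ * η ^ 2 * γ ^ 2 * γ' + e₂ * η ^ 2 * γ ^ 2 * γ' + e₁ * η ^ 2 * γ ^ 2 * γ' + v * η ^ 2 * γ ^ 2 * γ' + 2 * C₁ * η * γ ^ 2 * γ' +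 2 * C₁ * ρ * γ' ^ 3 + C₂ * α * γ' ^ 3 + 4 * C₁ * ρ * γ * γ' ^ 2 + e₂ * α ^ 2 * γ * γ' ^ 2 + e₂ * α * ρ * γ ^ 2 * γ' + 2 * e₁ * α * ρ * γ ^ 2 * γ' + 3 * v * α * ρ * γ ^ 2 * γ' + 2 * C₁ * ρ * γ ^ 2 * γ' + C₂ * α * γ ^ 2 * γ' + e₃ * α * η * γ' ^ 3 + C₂ * η * γ' ^ 3 + 2 * C₁ * α * γ' ^ 3 + 2 * e₃ * α * η * γ * γ' ^ 2 + 2 * C₂ * η * γ * γ' ^ 2 + 4 * C₁ * η * γ * γ' ^ 2 + 2 * e₂ * α * η * γ * γ' ^ 2 + 3 * v * α ^ 2 * γ * γ' ^ 2 + e₃ * α * η * γ ^ 2 * γ' + 2 * e₂ * α * η * γ ^ 2 * γ' + 3 * e₁ * α * η * γ ^ 2 * γ' + 4 * v * α * η * γ ^ 2 * γ' + 2 * C₁ * α * γ ^ 2 * γ' + 2 * C₂ * α * γ * γ' ^ 2 + 4 * C₁ * α * γ * γ' ^ 2 + 2 * e₁ * α ^ 2 * γ * γ' ^ 2 + e₂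 * α ^ 2 * γ ^ 2 * γ' + 2 * e₁ * α ^ 2 * γ ^ 2 * γ' + 3 * v * α ^ 2 * γ ^ 2 * γ'

/-- `Λ_A = certificate` with `C₁ = (1−α)A − αN − αM` (`= Cov_{G₁}(1_{a~b}, 1_{w~a∨w~b})`) and `C₂` the same covariance in `G₁/{a=y}`. [this work] -/
theorem xiB₁_lamA_eq_cert (α η γ A N M e₁ e₂ e₃ f₁ : R) :
    xiB₁_lamA α η γ A N M e₁ e₂ e₃ f₁ = xiB₁_certA α η (1 - α - η) γ (1 - γ) A (N - f₁) f₁ (M - e₁) e₁ e₂ e₃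
      ((1 - α) * A - α * N - α * M) ((1 - α - η) * (A + f₁ + e₁ + e₃) - (α + η) * (N - f₁) - (α + η) * (M - e₁ + e₂)) := by
  simp only [xiB₁_lamA, xiB₁_certA]
  ring

/-- First-order coefficient `Λ_B` of the AG⁺ first piece `xiB₁` at `V3 = CUT:b:ay|c` along the merge direction `ℬ¹` (merge `b` with `w` inside the `c ~ b` slice) (explicit cubic; variables as in the module docstring). [this work] -/
def xiB₁_lamB (_α _η γ _A _N M e₁ e₂ _e₃ _f₁ : R) : R :=
  -γ * e₂ + γ * e₁ - 3 * γ * M + e₂ - e₁ + 3 * M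

/-- Second-order coefficient of the same expansion (bookkeeping only). [this work] -/
def xiB₁_mergeR₂ (_α _η _γ _A _N _M _e₁ _e₂ _e₃ _f₁ : R) : R :=
  0

/-- Third-order coefficient of the same expansion (bookkeeping only). [this work] -/
def xiB₁_mergeR₃ (_α _η _γ _A _N _M _e₁ _e₂ _e₃ _f₁ : R) : R :=
  0

/-- **Expansion of `xiB₁` at the cut-vertex stratum `V3` along the merge direction `ℬ¹` (merge `b` with `w` inside the `c ~ b` slice)**: the value at `ε = 0` is `0` and the `ε`-coefficient is `xiB₁_lamB`. [this work] -/
theorem xiB₁_merge_expansion (α η γ A N M e₁ e₂ e₃ f₁ : R) (ε : R) :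
    xiB₁ (α * γ - γ - α + 1 + ε * (0)) (-α * γ + α + ε * (0)) (ε * (0)) (-α * γ + γ + ε * (-M)) (α * γ + ε * (M)) (-η * γ + η + ε * (0)) (ε * (0)) (ε * (0)) (ε * (0)) (η * γ + ε * (e₂ - e₁)) =
      ε * xiB₁_lamB α η γ A N M e₁ e₂ e₃ f₁ + ε ^ 2 * xiB₁_mergeR₂ α η γ A N M e₁ e₂ e₃ f₁ + ε ^ 3 * xiB₁_mergeR₃ α η γ A N M e₁ e₂ e₃ f₁ := by
  simp only [xiB₁, xiB₁_lamB, xiB₁_mergeR₂, xiB₁_mergeR₃]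
  ring

/-- Certificate form of `xiB₁_lamB`: a nonnegative integer combination of atom monomials (`ρ = 1−α−η`, `γ' = 1−γ`, `u = N−f₁`, `v = M−e₁`). [this work] -/
def xiB₁_certB (α η ρ _γ γ' _A _u _f₁ v e₁ e₂ _e₃ : R) : R :=
  e₂ * ρ ^ 2 * γ' + 2 * e₁ * ρ ^ 2 * γ' + 3 * v * ρ ^ 2 * γ' + 2 * e₂ * η * ρ * γ' + 4 * e₁ * η * ρ * γ' + 6 * v * η * ρ * γ' + e₂ * η ^ 2 * γ' + 2 * e₁ * η ^ 2 * γ' + 3 * v * η ^ 2 * γ' + 2 * e₂ * α * ρ * γ' + 4 * e₁ * α * ρ * γ' + 6 * v * α * ρ * γ' + 2 * e₂ * α * η * γ' + 4 * e₁ * α * η * γ' + 6 * v * α * η * γ' + e₂ * α ^ 2 * γ' + 2 * e₁ * α ^ 2 * γ' + 3 * v * α ^ 2 * γ'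

/-- `Λ_B = certificate`. [this work] -/
theorem xiB₁_lamB_eq_cert (α η γ A N M e₁ e₂ e₃ f₁ : R) :
    xiB₁_lamB α η γ A N M e₁ e₂ e₃ f₁ = xiB₁_certB α η (1 - α - η) γ (1 - γ) A (N - f₁) f₁ (M - e₁) e₁ e₂ e₃ := by
  simp only [xiB₁_lamB, xiB₁_certB]
  ring

/-- First-order coefficient `Λ_A` of the AG⁺ second piece `xiB₂` at `V3 = CUT:b:ay|c` along the attachment direction `F_A` (attach `c` to the side-1 vertex `w`) (explicit cubic; variables as in the module docstring). [this work] -/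
def xiB₂_lamA (α η γ A N M e₁ e₂ e₃ f₁ : R) : R :=
  η ^ 2 * γ ^ 3 * M + 2 * α * η * γ ^ 3 * e₂ - 2 * α * η * γ ^ 3 * e₁ + 4 * α * η * γ ^ 3 * M + 2 * α ^ 2 * γ ^ 3 * e₂ - 2 * α ^ 2 * γ ^ 3 * e₁ + 3 * α ^ 2 * γ ^ 3 * M - η * γ ^ 3 * e₂ + η * γ ^ 3 * e₁ - 2 * η * γ ^ 3 * M - 2 * η ^ 2 * γ ^ 2 * M - 2 * α * γ ^ 3 * e₂ + 2 * α * γ ^ 3 * e₁ - 3 * α * γ ^ 3 * M - 4 * α * η * γ ^ 2 * e₂ + 4 * α * η * γ ^ 2 * e₁ - 8 * α * η * γ ^ 2 * M - 4 * α ^ 2 * γ ^ 2 * e₂ + 4 * α ^ 2 * γ ^ 2 * e₁ - 6 * α ^ 2 * γ ^ 2 * M + η * γ ^ 2 * e₂ - η * γ ^ 2 * e₁ + 2 * η * γ ^ 2 * M + η ^ 2 * γ * M + 2 * α * γ ^ 2 * e₂ - 2 * α * γ ^ 2 * e₁ + 3 * α * γ ^ 2 * M + 2 * α * η * γ * e₂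 - 2 * α * η * γ * e₁ + 4 * α * η * γ * M + 2 * α ^ 2 * γ * e₂ - 2 * α ^ 2 * γ * e₁ + 3 * α ^ 2 * γ * M + η * γ * e₃ + η * γ * e₂ + 2 * η * γ * M + 2 * η * γ * N + 2 * η * γ * A + 2 * α * γ * e₃ + 2 * α * γ * e₂ + 3 * α * γ * M + 3 * α * γ * N + 3 * α * γ * A - 2 * γ * f₁ - 2 * γ * e₃ - 2 * γ * e₁ - 3 * γ * A - η * e₃ - η * e₂ - 2 * η * M - 2 * η * N - 2 * η * A - 2 * α * e₃ - 2 * α * e₂ - 3 * α * M - 3 * α * N - 3 * α * A + 2 * f₁ + 2 * e₃ + 2 * e₁ + 3 * A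

/-- Second-order coefficient of the same expansion (bookkeeping only). [this work] -/
def xiB₂_attachR₂ (α η γ A N M e₁ e₂ e₃ f₁ : R) : R :=
  -2 * η * γ ^ 3 * M * f₁ - η * γ ^ 3 * M * e₃ + 2 * η * γ ^ 3 * M * e₂ - 3 * η * γ ^ 3 * M * e₁ + 2 * η * γ ^ 3 * M ^ 2 + η * γ ^ 3 * N * e₂ - η * γ ^ 3 * N * e₁ + 2 * η * γ ^ 3 * N * M - η * γ ^ 3 * A * e₂ + η * γ ^ 3 * A * e₁ - 2 * η * γ ^ 3 * A * M - 2 * α * γ ^ 3 * e₂ * f₁ - α * γ ^ 3 * e₂ * e₃ + α * γ ^ 3 * e₂ ^ 2 + 2 * α * γ ^ 3 * e₁ * f₁ + α * γ ^ 3 * e₁ * e₃ - 3 * α * γ ^ 3 * e₁ * e₂ + 2 * α * γ ^ 3 * e₁ ^ 2 - 4 * α * γ ^ 3 * M * f₁ - 2 * α * γ ^ 3 * M * e₃ + 4 * α * γ ^ 3 * M * e₂ - 6 * α * γ ^ 3 * M * e₁ + 3 * α * γ ^ 3 * M ^ 2 + 2 * α * γ ^ 3 * N * e₂ - 2 * α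 * γ ^ 3 * N * e₁ + 3 * α * γ ^ 3 * N * M - 2 * α * γ ^ 3 * A * e₂ + 2 * α * γ ^ 3 * A * e₁ - 3 * α * γ ^ 3 * A * M + γ ^ 3 * e₂ * f₁ + γ ^ 3 * e₂ * e₃ - γ ^ 3 * e₁ * f₁ - γ ^ 3 * e₁ * e₃ + γ ^ 3 * e₁ * e₂ - γ ^ 3 * e₁ ^ 2 + 2 * γ ^ 3 * M * f₁ + 2 * γ ^ 3 * M * e₃ + 2 * γ ^ 3 * M * e₁ + 2 * γ ^ 3 * A * e₂ - 2 * γ ^ 3 * A * e₁ + 3 * γ ^ 3 * A * M + 5 * η * γ ^ 2 * M * f₁ + 2 * η * γ ^ 2 * M * e₃ - 4 * η * γ ^ 2 * M * e₂ + 6 * η * γ ^ 2 * M * e₁ - 4 * η * γ ^ 2 * M ^ 2 - 3 * η * γ ^ 2 * N * e₂ + 3 * η * γ ^ 2 * N * e₁ - 6 * η * γ ^ 2 * N * M + 2 * η * γ ^ 2 * A * e₂ - 2 * η * γ ^ 2 * A * e₁ + 4 * η * γ ^ 2 * A * M + 5 * α * γ ^ 2 * e₂ * f₁ + 2 * α *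 γ ^ 2 * e₂ * e₃ - 2 * α * γ ^ 2 * e₂ ^ 2 - 5 * α * γ ^ 2 * e₁ * f₁ - 2 * α * γ ^ 2 * e₁ * e₃ + 6 * α * γ ^ 2 * e₁ * e₂ - 4 * α * γ ^ 2 * e₁ ^ 2 + 10 * α * γ ^ 2 * M * f₁ + 4 * α * γ ^ 2 * M * e₃ - 8 * α * γ ^ 2 * M * e₂ + 12 * α * γ ^ 2 * M * e₁ - 6 * α * γ ^ 2 * M ^ 2 - 6 * α * γ ^ 2 * N * e₂ + 6 * α * γ ^ 2 * N * e₁ - 9 * α * γ ^ 2 * N * M + 4 * α * γ ^ 2 * A * e₂ - 4 * α * γ ^ 2 * A * e₁ + 6 * α * γ ^ 2 * A * M - γ ^ 2 * e₂ * f₁ - γ ^ 2 * e₂ * e₃ + γ ^ 2 * e₁ * f₁ + γ ^ 2 * e₁ * e₃ - γ ^ 2 * e₁ * e₂ + γ ^ 2 * e₁ ^ 2 - 2 * γ ^ 2 * M * f₁ - 2 * γ ^ 2 * M * e₃ - 2 * γ ^ 2 * M * e₁ - 2 * γ ^ 2 * A * e₂ + 2 * γ ^ 2 * A * e₁ - 3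 * γ ^ 2 * A * M - 4 * η * γ * M * f₁ - η * γ * M * e₃ + 2 * η * γ * M * e₂ - 3 * η * γ * M * e₁ + 2 * η * γ * M ^ 2 + 3 * η * γ * N * e₂ - 3 * η * γ * N * e₁ + 6 * η * γ * N * M - η * γ * A * e₂ + η * γ * A * e₁ - 2 * η * γ * A * M - 4 * α * γ * e₂ * f₁ - α * γ * e₂ * e₃ + α * γ * e₂ ^ 2 + 4 * α * γ * e₁ * f₁ + α * γ * e₁ * e₃ - 3 * α * γ * e₁ * e₂ + 2 * α * γ * e₁ ^ 2 - 8 * α * γ * M * f₁ - 2 * α * γ * M * e₃ + 4 * α * γ * M * e₂ - 6 * α * γ * M * e₁ + 3 * α * γ * M ^ 2 + 6 * α * γ * N * e₂ - 6 * α * γ * N * e₁ + 9 * α * γ * N * M - 2 * α * γ * A * e₂ + 2 * α * γ * A * e₁ - 3 * α * γ * A * M - γ * e₂ * f₁ + γ * e₁ * f₁ - 2 * γ * M * f₁ + 2 * γ * N * e₂ - 2 * γ * N * e₁ + 3 * γ * N * M + η * M * f₁ - η * N * e₂ + η * N * e₁ - 2 * η * N * M + α * e₂ * f₁ - α * e₁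 * f₁ + 2 * α * M * f₁ - 2 * α * N * e₂ + 2 * α * N * e₁ - 3 * α * N * M + e₂ * f₁ - e₁ * f₁ + 2 * M * f₁ - 2 * N * e₂ + 2 * N * e₁ - 3 * N * M

/-- Third-order coefficient of the same expansion (bookkeeping only). [this work] -/
def xiB₂_attachR₃ (_α _η γ A N M e₁ e₂ e₃ f₁ : R) : R :=
  γ ^ 3 * M * f₁ ^ 2 + γ ^ 3 * M * e₃ * f₁ - 2 * γ ^ 3 * M * e₂ * f₁ - 2 * γ ^ 3 * M * e₂ * e₃ + 3 * γ ^ 3 * M * e₁ * f₁ + 2 * γ ^ 3 * M * e₁ * e₃ - 2 * γ ^ 3 * M * e₁ * e₂ + 2 * γ ^ 3 * M * e₁ ^ 2 - 2 * γ ^ 3 * M ^ 2 * f₁ - 2 * γ ^ 3 * M ^ 2 * e₃ - 2 * γ ^ 3 * M ^ 2 * e₁ - γ ^ 3 * N * e₂ * f₁ - γ ^ 3 * N * e₂ * e₃ + γ ^ 3 * N * e₁ * f₁ + γ ^ 3 * N * e₁ * e₃ - γ ^ 3 * N * e₁ * e₂ + γ ^ 3 * N * e₁ ^ 2 - 2 *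 γ ^ 3 * N * M * f₁ - 2 * γ ^ 3 * N * M * e₃ - 2 * γ ^ 3 * N * M * e₁ + γ ^ 3 * A * e₂ * f₁ - γ ^ 3 * A * e₂ ^ 2 - γ ^ 3 * A * e₁ * f₁ + 2 * γ ^ 3 * A * e₁ * e₂ - γ ^ 3 * A * e₁ ^ 2 + 2 * γ ^ 3 * A * M * f₁ - 4 * γ ^ 3 * A * M * e₂ + 4 * γ ^ 3 * A * M * e₁ - 3 * γ ^ 3 * A * M ^ 2 - 2 * γ ^ 3 * A * N * e₂ + 2 * γ ^ 3 * A * N * e₁ - 3 * γ ^ 3 * A * N * M - 3 * γ ^ 2 * M * f₁ ^ 2 - 3 * γ ^ 2 * M * e₃ * f₁ + 4 * γ ^ 2 * M * e₂ * f₁ + 4 * γ ^ 2 * M * e₂ * e₃ - 7 * γ ^ 2 * M * e₁ * f₁ - 4 * γ ^ 2 * M * e₁ * e₃ + 4 * γ ^ 2 * M * e₁ * e₂ - 4 * γ ^ 2 * M * e₁ ^ 2 + 4 * γ ^ 2 * M ^ 2 * f₁ + 4 * γ ^ 2 * M ^ 2 * e₃ + 4 * γ ^ 2 * M ^ 2 *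 e₁ + 3 * γ ^ 2 * N * e₂ * f₁ + 3 * γ ^ 2 * N * e₂ * e₃ - 3 * γ ^ 2 * N * e₁ * f₁ - 3 * γ ^ 2 * N * e₁ * e₃ + 3 * γ ^ 2 * N * e₁ * e₂ - 3 * γ ^ 2 * N * e₁ ^ 2 + 6 * γ ^ 2 * N * M * f₁ + 6 * γ ^ 2 * N * M * e₃ + 6 * γ ^ 2 * N * M * e₁ - 3 * γ ^ 2 * A * e₂ * f₁ + 2 * γ ^ 2 * A * e₂ ^ 2 + 3 * γ ^ 2 * A * e₁ * f₁ - 4 * γ ^ 2 * A * e₁ * e₂ + 2 * γ ^ 2 * A * e₁ ^ 2 - 6 * γ ^ 2 * A * M * f₁ + 8 * γ ^ 2 * A * M * e₂ - 8 * γ ^ 2 * A * M * e₁ + 6 * γ ^ 2 * A * M ^ 2 + 6 * γ ^ 2 * A * N * e₂ - 6 * γ ^ 2 * A * N * e₁ + 9 * γ ^ 2 * A * N * M + 3 * γ * M * f₁ ^ 2 + 3 * γ * M * e₃ * f₁ - 2 * γ * M * e₂ * f₁ - 2 * γ * M * e₂ * e₃ + 5 * γ * M * e₁ * f₁ + 2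 * γ * M * e₁ * e₃ - 2 * γ * M * e₁ * e₂ + 2 * γ * M * e₁ ^ 2 - 2 * γ * M ^ 2 * f₁ - 2 * γ * M ^ 2 * e₃ - 2 * γ * M ^ 2 * e₁ - 3 * γ * N * e₂ * f₁ - 3 * γ * N * e₂ * e₃ + 3 * γ * N * e₁ * f₁ + 3 * γ * N * e₁ * e₃ - 3 * γ * N * e₁ * e₂ + 3 * γ * N * e₁ ^ 2 - 6 * γ * N * M * f₁ - 6 * γ * N * M * e₃ - 6 * γ * N * M * e₁ + 3 * γ * A * e₂ * f₁ - γ * A * e₂ ^ 2 - 3 * γ * A * e₁ * f₁ + 2 * γ * A * e₁ * e₂ - γ * A * e₁ ^ 2 + 6 * γ * A * M * f₁ - 4 * γ * A * M * e₂ + 4 * γ * A * M * e₁ - 3 * γ * A * M ^ 2 - 6 * γ * A * N * e₂ + 6 * γ * A * N * e₁ - 9 * γ * A * N * M - M * f₁ ^ 2 - M * e₃ * f₁ - M * e₁ * f₁ + N * e₂ * f₁ + N * e₂ * e₃ - N * e₁ * f₁ - N * e₁ * e₃ + N * e₁ * e₂ - N * e₁ ^ 2 + 2 * N * M * f₁ +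 2 * N * M * e₃ + 2 * N * M * e₁ - A * e₂ * f₁ + A * e₁ * f₁ - 2 * A * M * f₁ + 2 * A * N * e₂ - 2 * A * N * e₁ + 3 * A * N * M

/-- **Expansion of `xiB₂` at the cut-vertex stratum `V3` along the attachment direction `F_A` (attach `c` to the side-1 vertex `w`)**: the value at `ε = 0` is `0` and the `ε`-coefficient is `xiB₂_lamA`. [this work] -/
theorem xiB₂_attach_expansion (α η γ A N M e₁ e₂ e₃ f₁ : R) (ε : R) :
    xiB₂ (α * γ - γ - α + 1 + ε * (γ * M + γ * N - M - N)) (-α * γ + α + ε * (γ * A - A)) (ε * (-γ * M + M)) (-α * γ + γ + ε * (-γ * M - γ * N + N)) (α * γ + ε * (γ * M - γ * A + A)) (-η * γ + η + ε * (γ * f₁ + γ * e₁ - f₁ - e₁)) (ε * (-γ * e₂ + e₂)) (ε * (-γ * e₃ + e₃)) (ε * (-γ * e₁ + e₁)) (η * γ + ε * (-γ * f₁ + γ * e₂ - γ * e₁ + f₁)) =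
      ε * xiB₂_lamA α η γ A N M e₁ e₂ e₃ f₁ + ε ^ 2 * xiB₂_attachR₂ α η γ A N M e₁ e₂ e₃ f₁ + ε ^ 3 * xiB₂_attachR₃ α η γ A N M e₁ e₂ e₃ f₁ := by
  simp only [xiB₂, xiB₂_lamA, xiB₂_attachR₂, xiB₂_attachR₃]
  ring

/-- Certificate form of `xiB₂_lamA`: a nonnegative integer combination of the two Harris covariances `C₁, C₂` and the atoms (`ρ = 1−α−η`, `γ' = 1−γ`, `u = N−f₁`, `v = M−e₁`). [this work] -/
def xiB₂_certA (α η ρ γ γ' _A _u _f₁ v e₁ e₂ e₃ C₁ C₂ : R) : R :=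
  e₂ * η * ρ * γ' ^ 3 + 4 * C₂ * ρ * γ * γ' ^ 2 + 2 * C₂ * ρ * γ ^ 2 * γ' + e₃ * η * ρ * γ' ^ 3 + 2 * C₂ * ρ * γ' ^ 3 + C₁ * ρ * γ' ^ 3 + 2 * e₃ * η * ρ * γ * γ' ^ 2 + v * η ^ 2 * γ * γ' ^ 2 + 2 * e₂ * η * ρ * γ * γ' ^ 2 + 2 * C₁ * ρ * γ * γ' ^ 2 + e₃ * η * ρ * γ ^ 2 * γ' + 2 * e₂ * η * ρ * γ ^ 2 * γ' + e₁ * η * ρ * γ ^ 2 * γ' + 2 * v * η * ρ * γ ^ 2 * γ' + C₁ * ρ * γ ^ 2 * γ' + e₃ * η ^ 2 * γ' ^ 3 + 2 * C₂ * η * γ' ^ 3 + C₁ * η * γ' ^ 3 + 2 * e₃ * η ^ 2 * γ * γ' ^ 2 + 4 * v * α * η * γ * γ' ^ 2 + e₁ * η ^ 2 * γ * γ' ^ 2 + 2 * e₂ * η ^ 2 * γ * γ' ^ 2 + 2 * C₁ * η * γ * γ' ^ 2 + e₃ * η ^ 2 * γ ^ 2 * γ' + 2 * e₂ * η ^ 2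 * γ ^ 2 * γ' + e₁ * η ^ 2 * γ ^ 2 * γ' + 2 * v * η ^ 2 * γ ^ 2 * γ' + C₁ * η * γ ^ 2 * γ' + e₂ * α * η * γ' ^ 3 + 2 * C₂ * α * γ' ^ 3 + 2 * e₂ * α ^ 2 * γ * γ' ^ 2 + 2 * e₂ * α * ρ * γ ^ 2 * γ' + e₁ * α * ρ * γ ^ 2 * γ' + 3 * v * α * ρ * γ ^ 2 * γ' + 2 * C₂ * η * γ ^ 2 * γ' + 2 * C₂ * α * γ ^ 2 * γ' + e₃ * α * η * γ' ^ 3 + e₂ * η ^ 2 * γ' ^ 3 + C₁ * α * γ' ^ 3 + 2 * e₃ * α * η * γ * γ' ^ 2 + 4 * C₂ * η * γ * γ' ^ 2 + 2 * e₁ * α * η * γ * γ' ^ 2 + 4 * e₂ * α * η * γ * γ' ^ 2 + e₁ * α ^ 2 * γ * γ' ^ 2 + e₃ * α * η * γ ^ 2 * γ' + 4 * e₂ * α * η * γ ^ 2 * γ' + 2 * e₁ * α * η * γ ^ 2 * γ' + 5 * v * α * η * γ ^ 2 * γ' + C₁ * α * γ ^ 2 * γ' + 3 * v * α ^ 2 *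 γ * γ' ^ 2 + 2 * C₁ * α * γ * γ' ^ 2 + 4 * C₂ * α * γ * γ' ^ 2 + 2 * e₂ * α ^ 2 * γ ^ 2 * γ' + e₁ * α ^ 2 * γ ^ 2 * γ' + 3 * v * α ^ 2 * γ ^ 2 * γ'

/-- `Λ_A = certificate` with `C₁ = (1−α)A − αN − αM` (`= Cov_{G₁}(1_{a~b}, 1_{w~a∨w~b})`) and `C₂` the same covariance in `G₁/{a=y}`. [this work] -/
theorem xiB₂_lamA_eq_cert (α η γ A N M e₁ e₂ e₃ f₁ : R) :
    xiB₂_lamA α η γ A N M e₁ e₂ e₃ f₁ = xiB₂_certA α η (1 - α - η) γ (1 - γ) A (N - f₁) f₁ (M - e₁) e₁ e₂ e₃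
      ((1 - α) * A - α * N - α * M) ((1 - α - η) * (A + f₁ + e₁ + e₃) - (α + η) * (N - f₁) - (α + η) * (M - e₁ + e₂)) := by
  simp only [xiB₂_lamA, xiB₂_certA]
  ring

/-- First-order coefficient `Λ_B` of the AG⁺ second piece `xiB₂` at `V3 = CUT:b:ay|c` along the merge direction `ℬ¹` (merge `b` with `w` inside the `c ~ b` slice) (explicit cubic; variables as in the module docstring). [this work] -/
def xiB₂_lamB (_α _η γ _A _N M e₁ e₂ _e₃ _f₁ : R) : R :=
  -2 * γ * e₂ + 2 * γ * e₁ - 3 * γ * M + 2 * e₂ - 2 * e₁ + 3 * M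

/-- Second-order coefficient of the same expansion (bookkeeping only). [this work] -/
def xiB₂_mergeR₂ (_α _η _γ _A _N _M _e₁ _e₂ _e₃ _f₁ : R) : R :=
  0

/-- Third-order coefficient of the same expansion (bookkeeping only). [this work] -/
def xiB₂_mergeR₃ (_α _η _γ _A _N _M _e₁ _e₂ _e₃ _f₁ : R) : R :=
  0

/-- **Expansion of `xiB₂` at the cut-vertex stratum `V3` along the merge direction `ℬ¹` (merge `b` with `w` inside the `c ~ b` slice)**: the value at `ε = 0` is `0` and the `ε`-coefficient is `xiB₂_lamB`. [this work] -/
theorem xiB₂_merge_expansion (α η γ A N M e₁ e₂ e₃ f₁ : R) (ε : R) :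
    xiB₂ (α * γ - γ - α + 1 + ε * (0)) (-α * γ + α + ε * (0)) (ε * (0)) (-α * γ + γ + ε * (-M)) (α * γ + ε * (M)) (-η * γ + η + ε * (0)) (ε * (0)) (ε * (0)) (ε * (0)) (η * γ + ε * (e₂ - e₁)) =
      ε * xiB₂_lamB α η γ A N M e₁ e₂ e₃ f₁ + ε ^ 2 * xiB₂_mergeR₂ α η γ A N M e₁ e₂ e₃ f₁ + ε ^ 3 * xiB₂_mergeR₃ α η γ A N M e₁ e₂ e₃ f₁ := by
  simp only [xiB₂, xiB₂_lamB, xiB₂_mergeR₂, xiB₂_mergeR₃]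
  ring

/-- Certificate form of `xiB₂_lamB`: a nonnegative integer combination of atom monomials (`ρ = 1−α−η`, `γ' = 1−γ`, `u = N−f₁`, `v = M−e₁`). [this work] -/
def xiB₂_certB (α η ρ _γ γ' _A _u _f₁ v e₁ e₂ _e₃ : R) : R :=
  2 * e₂ * ρ ^ 2 * γ' + e₁ * ρ ^ 2 * γ' + 3 * v * ρ ^ 2 * γ' + 4 * e₂ * η * ρ * γ' + 2 * e₁ * η * ρ * γ' + 6 * v * η * ρ * γ' + 2 * e₂ * η ^ 2 * γ' + e₁ * η ^ 2 * γ' + 3 * v * η ^ 2 * γ' + 4 * e₂ * α * ρ * γ' + 2 * e₁ * α * ρ * γ' + 6 * v * α * ρ * γ' + 4 * e₂ * α * η * γ' + 2 * e₁ * α * η * γ' + 6 * v * α * η * γ' + 2 * e₂ * α ^ 2 * γ' + e₁ * α ^ 2 * γ' + 3 * v * α ^ 2 * γ'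

/-- `Λ_B = certificate`. [this work] -/
theorem xiB₂_lamB_eq_cert (α η γ A N M e₁ e₂ e₃ f₁ : R) :
    xiB₂_lamB α η γ A N M e₁ e₂ e₃ f₁ = xiB₂_certB α η (1 - α - η) γ (1 - γ) A (N - f₁) f₁ (M - e₁) e₁ e₂ e₃ := by
  simp only [xiB₂_lamB, xiB₂_certB]
  ring

end Algebra

/-! ## Signs over `ℝ` -/

section Real

/-- The certificate `xiB₁_certA` is nonnegative when its (used) arguments are. [this work] -/
theorem xiB₁_certA_nonneg {α η ρ γ γ' A u f₁ v e₁ e₂ e₃ C₁ C₂ : ℝ} (hα : 0 ≤ α) (hη : 0 ≤ η) (hρ : 0 ≤ ρ) (hγ : 0 ≤ γ) (hγ' : 0 ≤ γ') (hv : 0 ≤ v) (he₁ : 0 ≤ e₁) (he₂ : 0 ≤ e₂) (he₃ : 0 ≤ e₃) (hC₁ : 0 ≤ C₁) (hC₂ : 0 ≤ C₂) :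
    0 ≤ xiB₁_certA α η ρ γ γ' A u f₁ v e₁ e₂ e₃ C₁ C₂ := by
  unfold xiB₁_certA
  positivity

/-- **`Λ_A ≥ 0` for the AG⁺ first piece**: first-order nonnegativity of `xiB₁` at `V3` along the attachment direction, from the two HARRIS covariances `C₁ ≥ 0` (in `G₁`) and `C₂ ≥ 0` (in `G₁/{a=y}`) of the hidden attachment vertex `w` and the atom signs. [this work] -/
theorem xiB₁_lamA_nonneg {α η γ A N M e₁ e₂ e₃ f₁ : ℝ} (hα : 0 ≤ α) (hη : 0 ≤ η) (hρ : α + η ≤ 1) (hγ : 0 ≤ γ) (hγ1 : γ ≤ 1) (hM : e₁ ≤ M) (he₁ : 0 ≤ e₁) (he₂ : 0 ≤ e₂) (he₃ : 0 ≤ e₃)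
    (hC₁ : 0 ≤ (1 - α) * A - α * N - α * M) (hC₂ : 0 ≤ (1 - α - η) * (A + f₁ + e₁ + e₃) - (α + η) * (N - f₁) - (α + η) * (M - e₁ + e₂)) :
    0 ≤ xiB₁_lamA α η γ A N M e₁ e₂ e₃ f₁ := by
  rw [xiB₁_lamA_eq_cert]
  exact xiB₁_certA_nonneg hα hη (by linarith) hγ (by linarith) (by linarith) he₁ he₂ he₃ hC₁ hC₂

/-- The certificate `xiB₁_certB` is nonnegative when its (used) arguments are. [this work] -/
theorem xiB₁_certB_nonneg {α η ρ γ γ' A u f₁ v e₁ e₂ e₃ : ℝ} (hα : 0 ≤ α) (hη : 0 ≤ η) (hρ : 0 ≤ ρ) (hγ' : 0 ≤ γ') (hv : 0 ≤ v) (he₁ : 0 ≤ e₁) (he₂ : 0 ≤ e₂) :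
    0 ≤ xiB₁_certB α η ρ γ γ' A u f₁ v e₁ e₂ e₃ := by
  unfold xiB₁_certB
  positivity

/-- **`Λ_B ≥ 0` for the AG⁺ first piece** (merge direction; no covariance needed). [this work] -/
theorem xiB₁_lamB_nonneg {α η γ A N M e₁ e₂ e₃ f₁ : ℝ} (hα : 0 ≤ α) (hη : 0 ≤ η) (hρ : α + η ≤ 1) (hγ1 : γ ≤ 1) (hM : e₁ ≤ M) (he₁ : 0 ≤ e₁) (he₂ : 0 ≤ e₂) :
    0 ≤ xiB₁_lamB α η γ A N M e₁ e₂ e₃ f₁ := by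
  rw [xiB₁_lamB_eq_cert]
  exact xiB₁_certB_nonneg hα hη (by linarith) (by linarith) (by linarith) he₁ he₂

/-- **General elementary identification `w ~ w′`**: the division-free first-order derivative `ρ'·Λ_A + (κ₂(1−γ) − γ(κ₁+ρ'))·Λ_B` of `xiB₁` is nonnegative whenever the `(b,w′,c)` law of `G₂` satisfies AG (`κ₂(1−γ) − γ(κ₁+ρ') ≥ κ₁ρ' ≥ 0`, van den Berg–Kesten / Gladkov) — taken here as the hypothesis `hAG`. [this work] -/
theorem xiB₁_derivative_comb_nonneg {α η γ A N M e₁ e₂ e₃ f₁ ρ' κ₁ κ₂ : ℝ} (hα : 0 ≤ α) (hη : 0 ≤ η) (hρ : α + η ≤ 1) (hγ : 0 ≤ γ) (hγ1 : γ ≤ 1) (hM : e₁ ≤ M) (he₁ : 0 ≤ e₁) (he₂ : 0 ≤ e₂) (he₃ : 0 ≤ e₃)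
    (hC₁ : 0 ≤ (1 - α) * A - α * N - α * M) (hC₂ : 0 ≤ (1 - α - η) * (A + f₁ + e₁ + e₃) - (α + η) * (N - f₁) - (α + η) * (M - e₁ + e₂))
    (hρ' : 0 ≤ ρ') (hAG : 0 ≤ κ₂ * (1 - γ) - γ * (κ₁ + ρ')) :
    0 ≤ ρ' * xiB₁_lamA α η γ A N M e₁ e₂ e₃ f₁ + (κ₂ * (1 - γ) - γ * (κ₁ + ρ')) * xiB₁_lamB α η γ A N M e₁ e₂ e₃ f₁ :=
  add_nonneg (mul_nonneg hρ' (xiB₁_lamA_nonneg hα hη hρ hγ hγ1 hM he₁ he₂ he₃ hC₁ hC₂))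
    (mul_nonneg hAG (xiB₁_lamB_nonneg hα hη hρ hγ1 hM he₁ he₂))

/-- The certificate `xiB₂_certA` is nonnegative when its (used) arguments are. [this work] -/
theorem xiB₂_certA_nonneg {α η ρ γ γ' A u f₁ v e₁ e₂ e₃ C₁ C₂ : ℝ} (hα : 0 ≤ α) (hη : 0 ≤ η) (hρ : 0 ≤ ρ) (hγ : 0 ≤ γ) (hγ' : 0 ≤ γ') (hv : 0 ≤ v) (he₁ : 0 ≤ e₁) (he₂ : 0 ≤ e₂) (he₃ : 0 ≤ e₃) (hC₁ : 0 ≤ C₁) (hC₂ : 0 ≤ C₂) :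
    0 ≤ xiB₂_certA α η ρ γ γ' A u f₁ v e₁ e₂ e₃ C₁ C₂ := by
  unfold xiB₂_certA
  positivity

/-- **`Λ_A ≥ 0` for the AG⁺ second piece**: first-order nonnegativity of `xiB₂` at `V3` along the attachment direction, from the two HARRIS covariances `C₁ ≥ 0` (in `G₁`) and `C₂ ≥ 0` (in `G₁/{a=y}`) of the hidden attachment vertex `w` and the atom signs. [this work] -/
theorem xiB₂_lamA_nonneg {α η γ A N M e₁ e₂ e₃ f₁ : ℝ} (hα : 0 ≤ α) (hη : 0 ≤ η) (hρ : α + η ≤ 1) (hγ : 0 ≤ γ) (hγ1 : γ ≤ 1) (hM : e₁ ≤ M) (he₁ : 0 ≤ e₁) (he₂ : 0 ≤ e₂) (he₃ : 0 ≤ e₃)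
    (hC₁ : 0 ≤ (1 - α) * A - α * N - α * M) (hC₂ : 0 ≤ (1 - α - η) * (A + f₁ + e₁ + e₃) - (α + η) * (N - f₁) - (α + η) * (M - e₁ + e₂)) :
    0 ≤ xiB₂_lamA α η γ A N M e₁ e₂ e₃ f₁ := by
  rw [xiB₂_lamA_eq_cert]
  exact xiB₂_certA_nonneg hα hη (by linarith) hγ (by linarith) (by linarith) he₁ he₂ he₃ hC₁ hC₂

/-- The certificate `xiB₂_certB` is nonnegative when its (used) arguments are. [this work] -/
theorem xiB₂_certB_nonneg {α η ρ γ γ' A u f₁ v e₁ e₂ e₃ : ℝ} (hα : 0 ≤ α) (hη : 0 ≤ η) (hρ : 0 ≤ ρ) (hγ' : 0 ≤ γ') (hv : 0 ≤ v) (he₁ : 0 ≤ e₁) (he₂ : 0 ≤ e₂) :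
    0 ≤ xiB₂_certB α η ρ γ γ' A u f₁ v e₁ e₂ e₃ := by
  unfold xiB₂_certB
  positivity

/-- **`Λ_B ≥ 0` for the AG⁺ second piece** (merge direction; no covariance needed). [this work] -/
theorem xiB₂_lamB_nonneg {α η γ A N M e₁ e₂ e₃ f₁ : ℝ} (hα : 0 ≤ α) (hη : 0 ≤ η) (hρ : α + η ≤ 1) (hγ1 : γ ≤ 1) (hM : e₁ ≤ M) (he₁ : 0 ≤ e₁) (he₂ : 0 ≤ e₂) :
    0 ≤ xiB₂_lamB α η γ A N M e₁ e₂ e₃ f₁ := by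
  rw [xiB₂_lamB_eq_cert]
  exact xiB₂_certB_nonneg hα hη (by linarith) (by linarith) (by linarith) he₁ he₂

/-- **General elementary identification `w ~ w′`**: the division-free first-order derivative `ρ'·Λ_A + (κ₂(1−γ) − γ(κ₁+ρ'))·Λ_B` of `xiB₂` is nonnegative whenever the `(b,w′,c)` law of `G₂` satisfies AG (`κ₂(1−γ) − γ(κ₁+ρ') ≥ κ₁ρ' ≥ 0`, van den Berg–Kesten / Gladkov) — taken here as the hypothesis `hAG`. [this work] -/
theorem xiB₂_derivative_comb_nonneg {α η γ A N M e₁ e₂ e₃ f₁ ρ' κ₁ κ₂ : ℝ} (hα : 0 ≤ α) (hη : 0 ≤ η) (hρ : α + η ≤ 1) (hγ : 0 ≤ γ) (hγ1 : γ ≤ 1) (hM : e₁ ≤ M) (he₁ : 0 ≤ e₁) (he₂ : 0 ≤ e₂) (he₃ : 0 ≤ e₃)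
    (hC₁ : 0 ≤ (1 - α) * A - α * N - α * M) (hC₂ : 0 ≤ (1 - α - η) * (A + f₁ + e₁ + e₃) - (α + η) * (N - f₁) - (α + η) * (M - e₁ + e₂))
    (hρ' : 0 ≤ ρ') (hAG : 0 ≤ κ₂ * (1 - γ) - γ * (κ₁ + ρ')) :
    0 ≤ ρ' * xiB₂_lamA α η γ A N M e₁ e₂ e₃ f₁ + (κ₂ * (1 - γ) - γ * (κ₁ + ρ')) * xiB₂_lamB α η γ A N M e₁ e₂ e₃ f₁ :=
  add_nonneg (mul_nonneg hρ' (xiB₂_lamA_nonneg hα hη hρ hγ hγ1 hM he₁ he₂ he₃ hC₁ hC₂))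
    (mul_nonneg hAG (xiB₂_lamB_nonneg hα hη hρ hγ1 hM he₁ he₂))

end Real

end Summit.CriticalPhenomena.PercolationContinuityZ3.Theorems.TerminalEdgeStep.CutVertexFirstOrderXi
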